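import Mathlib
import Summits.ResolutionOfSingularities.ResolutionOfSingularities.Theorems.RadicialJungCleanModelsCleanLU3CompositeDownstairsDom
import Summits.ResolutionOfSingularities.ResolutionOfSingularities.Theorems.RadicialJungCleanModelsLens5AbsDerivation
import HarnessLib

/-!
# Route `RadicialJung`, crux `CleanModels` (stmt-15917), stub `stub_cleanLU3DefectNonDiscrete`, sub-line (C-div): preliminaries for the
# DOWNSTAIRS ASSEMBLY over the PERSIST stubs of workfile v3

Line `Sketch` rev 24 of crux stmt-ResolutionOfSingularities-15917; lead `res-B-lead-1` g4 (workfile `Lines/Sketch_Cdiv_assembly.lean` v3).  OURS;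
nothing here proves resolution in characteristic `p`.

* `exists_span_pair_of_not_mem_sq` — in a local ring with `𝔪 = (x₀, x₁)`, an element of `𝔪 ∖ 𝔪²` is part of a generating pair;
* `exists_derivation_residueField_of_model` — every non-`p`-th power of the residue field of `locAtCentre Ā Ō` (a field finitely generated
  over `k` when the centre is closed) is moved by a derivation (✓ D-abs, `Lens5.AbsDerivation.absDerivation_of_forall_pow_ne'`) — the
  hypothesis `hDer` of `stub_persistE2`;
* `form_one_or_two_of_form` — form (3) `s`, `s − γ^p = z ∈ 𝔪 ∖ 𝔪²`, is normalised to form (1) `z = 1·z¹·z₂⁰` in an r.s.p. `(z, z₂)` by the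
  shift `c₀ ↦ c₀ − γ`, keeping the coefficient integrality and non-triviality (the input shape of `stub_persistCases`).
-/

noncomputable section

set_option linter.dupNamespace false -- mandated namespace of this single-conjunct summit

open IsLocalRing AlgebraicGeometry CategoryTheory
open Literature.AlgebraicGeometry.Resolution

namespace Summit.ResolutionOfSingularities.ResolutionOfSingularities.Theorems.RadicialJung.CleanModels

variable {κ : Type} [Field κ] {k : Type} [Field k] [Algebra k κ]

/-- In a local ring with `𝔪 = (x₀, x₁)`, an element `π ∈ 𝔪 ∖ 𝔪²` is part of a generating pair `(π, z)` of `𝔪`. [folklore] -/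
theorem exists_span_pair_of_not_mem_sq {S : Type*} [CommRing S] [IsLocalRing S] (x₀ x₁ π : S)
    (hm : maximalIdeal S = Ideal.span {x₀, x₁}) (hπ : π ∈ maximalIdeal S) (hπ2 : π ∉ maximalIdeal S ^ 2) :
    ∃ z : S, maximalIdeal S = Ideal.span {π, z} := by
  have hx₀ : x₀ ∈ maximalIdeal S := by rw [hm]; exact Ideal.subset_span (by simp)
  have hx₁ : x₁ ∈ maximalIdeal S := by rw [hm]; exact Ideal.subset_span (by simp)
  rw [hm] at hπ
  obtain ⟨a₀, a₁, hπeq⟩ := Ideal.mem_span_pair.mp hπ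
  have key : ∀ (y₀ y₁ b₀ b₁ : S), maximalIdeal S = Ideal.span {y₀, y₁} → b₀ * y₀ + b₁ * y₁ = π → IsUnit b₀ →
      maximalIdeal S = Ideal.span {π, y₁} := by
    intro y₀ y₁ b₀ b₁ hm' hπ' hb₀
    obtain ⟨u, rfl⟩ := hb₀
    rw [hm']
    apply le_antisymm
    · rw [Ideal.span_le]
      rintro w (rfl | rfl)
      · -- `y₀ = u⁻¹ (π − b₁ y₁)`
        have : w = (↑u⁻¹ : S) * (π - b₁ * y₁) := by
          rw [← hπ', add_sub_cancel_right, ← mul_assoc, Units.inv_mul, one_mul]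
        rw [this]
        exact Ideal.mul_mem_left _ _ (Ideal.sub_mem _ (Ideal.subset_span (by simp))
          (Ideal.mul_mem_left _ _ (Ideal.subset_span (by simp))))
      · exact Ideal.subset_span (by simp)
    · rw [Ideal.span_le]
      rintro w (rfl | rfl)
      · rw [← hπ']
        exact Ideal.add_mem _ (Ideal.mul_mem_left _ _ (Ideal.subset_span (by simp)))
          (Ideal.mul_mem_left _ _ (Ideal.subset_span (by simp)))
      · exact Ideal.subset_span (by simp)
  by_cases h₀ : IsUnit a₀
  · exact ⟨x₁, key x₀ x₁ a₀ a₁ hm hπeq h₀⟩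
  by_cases h₁ : IsUnit a₁
  · exact ⟨x₀, key x₁ x₀ a₁ a₀ (by rw [hm, Set.pair_comm]) (by rw [← hπeq]; ring) h₁⟩
  refine absurd ?_ hπ2
  have hm' : ∀ a : S, ¬ IsUnit a → a ∈ maximalIdeal S := fun a ha => (mem_maximalIdeal _).mpr (mem_nonunits_iff.mpr ha)
  rw [← hπeq, pow_two]
  exact Ideal.add_mem _ (Ideal.mul_mem_mul (hm' _ h₀) hx₀) (Ideal.mul_mem_mul (hm' _ h₁) hx₁)

/-- **Every non-`p`-th power of the residue field of a finitely generated model at a closed centre is moved by a derivation**: the residue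
field of `locAtCentre Ā Ō` is the field `Ā/𝔮` (`𝔮` the maximal centre), finitely generated over `k`, to which ✓ D-abs
(`Lens5.AbsDerivation.absDerivation_of_forall_pow_ne'`) applies. [folklore] -/
theorem exists_derivation_residueField_of_model (p : ℕ) (hp : p.Prime) [CharP k p]
    (Ō : ValuationSubring κ) (Ā : Subalgebra k κ) (hĀŌ : Ā.toSubring ≤ Ō.toSubring) (hĀfg : Ā.FG)
    (hmax : (subringCentre Ā.toSubring Ō hĀŌ).IsMaximal)
    (S : Subring κ) [IsLocalRing S] (hS : S = locAtCentre Ā.toSubring Ō)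
    (a : ResidueField S) (ha : ∀ b : ResidueField S, b ^ p ≠ a) :
    ∃ D : Derivation ℤ (ResidueField S) (ResidueField S), D a ≠ 0 := by
  classical
  subst hS
  have hĀS : Ā.toSubring ≤ locAtCentre Ā.toSubring Ō := le_locAtCentre _ Ō
  have hSŌ : locAtCentre Ā.toSubring Ō ≤ Ō.toSubring := locAtCentre_le hĀŌ
  let ι : Ā.toSubring →+* locAtCentre Ā.toSubring Ō := Subring.inclusion hĀS
  let φ : Ā →+* ResidueField (locAtCentre Ā.toSubring Ō) := (residue _).comp ι
  letI : Algebra k (ResidueField (locAtCentre Ā.toSubring Ō)) := (φ.comp (algebraMap k Ā)).toAlgebra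
  haveI : CharP (ResidueField (locAtCentre Ā.toSubring Ō)) p :=
    charP_of_injective_algebraMap (algebraMap k (ResidueField (locAtCentre Ā.toSubring Ō))).injective p
  let φₐ : Ā →ₐ[k] ResidueField (locAtCentre Ā.toSubring Ō) := { φ with commutes' := fun c => rfl }
  -- `φ` is surjective: `y/z ≡ y·z'` modulo `𝔪` for an inverse `z'` of `z` modulo the (maximal) centre
  have hsurj : Function.Surjective φₐ := by
    intro r
    obtain ⟨s, rfl⟩ := residue_surjective r
    obtain ⟨y, hy, z, hz, hvz, hs⟩ := s.2
    have hz𝔮 : (⟨z, hz⟩ : Ā.toSubring) ∉ subringCentre Ā.toSubring Ō hĀŌ := by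
      rw [mem_subringCentre_iff]; change ¬ Ō.valuation z < 1; rw [hvz]; exact lt_irrefl _
    obtain ⟨z', hz'⟩ : ∃ z' : Ā.toSubring, (⟨z, hz⟩ : Ā.toSubring) * z' - 1 ∈ subringCentre Ā.toSubring Ō hĀŌ := by
      have hF := (Ideal.Quotient.maximal_ideal_iff_isField_quotient _).mp hmax
      have hne : Ideal.Quotient.mk (subringCentre Ā.toSubring Ō hĀŌ) ⟨z, hz⟩ ≠ 0 := by
        rwa [Ne, Ideal.Quotient.eq_zero_iff_mem]
      obtain ⟨w, hw⟩ := hF.mul_inv_cancel hne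
      obtain ⟨z', rfl⟩ := Ideal.Quotient.mk_surjective w
      refine ⟨z', ?_⟩
      rw [← Ideal.Quotient.eq_zero_iff_mem, map_sub, map_mul, map_one, hw, sub_self]
    refine ⟨((⟨y, hy⟩ : Ā.toSubring) * z' : Ā.toSubring), ?_⟩
    change residue _ (ι (⟨y, hy⟩ * z')) = residue _ s
    rw [← sub_eq_zero, ← map_sub, residue_eq_zero_iff, mem_maximalIdeal_locAtCentre_iff hĀŌ]
    have hv1 := (mem_subringCentre_iff hĀŌ _).mp hz'
    have hz0 : z ≠ 0 := ne_zero_of_valuation_eq_one hvz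
    have hvy : Ō.valuation y ≤ 1 := (Ō.valuation_le_one_iff _).mpr (hĀŌ hy)
    have e : ((ι (⟨y, hy⟩ * z') - s : locAtCentre Ā.toSubring Ō) : κ) = y * (z * (z' : κ) - 1) / z := by
      push_cast
      change y * (z' : κ) - (s : κ) = _
      rw [hs]
      field_simp
    rw [e, map_div₀, map_mul, hvz, div_one]
    calc Ō.valuation y * Ō.valuation (z * (z' : κ) - 1) ≤ 1 * Ō.valuation (z * (z' : κ) - 1) :=
          mul_le_mul' hvy le_rfl
      _ < 1 := by rw [one_mul]; exact hv1
  haveI : Algebra.FiniteType k Ā := Ā.fg_iff_finiteType.mp hĀfg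
  haveI : Algebra.FiniteType k (ResidueField (locAtCentre Ā.toSubring Ō)) := Algebra.FiniteType.of_surjective φₐ hsurj
  have hfg : (⊤ : Subalgebra k (ResidueField (locAtCentre Ā.toSubring Ō))).FG := Algebra.FiniteType.out
  have hfrac : IsFractionRing (⊤ : Subalgebra k (ResidueField (locAtCentre Ā.toSubring Ō)))
      (ResidueField (locAtCentre Ā.toSubring Ō)) :=
    IsFractionRing.of_field _ _ fun z => ⟨⟨z, Algebra.mem_top⟩, 1, by rw [map_one, div_one]; rfl⟩
  obtain ⟨D, -, -, -, hDa⟩ := Lens5.AbsDerivation.absDerivation_of_forall_pow_ne' p hp k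
    (ResidueField (locAtCentre Ā.toSubring Ō)) ⊤ hfg hfrac a (fun c hc => ha c hc)
  exact ⟨D, hDa⟩

/-- **Normalising form (3) to form (1)** (same ring): if `Σ c_j^p ū^j = s` with `s − γ^p = z ∈ 𝔪 ∖ 𝔪²`, shift `c₀ ↦ c₀ − γ`; then
`Σ c'_j^p ū^j = z = 1·z¹·z₂⁰` in an r.s.p. `(z, z₂)` (`exists_span_pair_of_not_mem_sq`), the integrality `c'_j · d · x^α y^β ∈ R` is kept and
`c'` is still non-trivial. Forms (1), (2) are returned unchanged. [folklore] -/
theorem form_one_or_two_of_form (p : ℕ) [hp : Fact p.Prime] [CharP κ p] (R : Subring κ) [IsLocalRing R]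
    (ū d : κ) (hd : d ∈ R) (c : Fin p → κ) (hc : ∃ j : Fin p, (j : ℕ) ≠ 0 ∧ c j ≠ 0)
    (x y : R) (hxy : maximalIdeal R = Ideal.span {x, y}) (α β : ℕ)
    (hden : ∀ j : Fin p, c j * d * (x : κ) ^ α * (y : κ) ^ β ∈ R)
    (hform : (∃ (x₁ y₁ : R), maximalIdeal R = Ideal.span {x₁, y₁} ∧ ∃ (a b : ℕ) (ε : R), IsUnit ε ∧ (a ≠ 0 ∨ b ≠ 0) ∧
        (a = 0 ∨ ¬ p ∣ a) ∧ (b = 0 ∨ ¬ p ∣ b) ∧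
        (∑ j : Fin p, c j ^ p * ū ^ (j : ℕ)) = (ε : κ) * (x₁ : κ) ^ a * (y₁ : κ) ^ b) ∨
      (∃ u : R, IsUnit u ∧ (∑ j : Fin p, c j ^ p * ū ^ (j : ℕ)) = (u : κ) ∧ ∀ c' : R, u - c' ^ p ∉ maximalIdeal R) ∨
      (∃ s c' : R, (∑ j : Fin p, c j ^ p * ū ^ (j : ℕ)) = (s : κ) ∧ s - c' ^ p ∈ maximalIdeal R ∧
        s - c' ^ p ∉ maximalIdeal R ^ 2)) :
    ∃ c' : Fin p → κ, (∃ j : Fin p, (j : ℕ) ≠ 0 ∧ c' j ≠ 0) ∧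
      (∀ j : Fin p, c' j * d * (x : κ) ^ α * (y : κ) ^ β ∈ R) ∧
      ((∃ (x₁ y₁ : R), maximalIdeal R = Ideal.span {x₁, y₁} ∧ ∃ (a b : ℕ) (ε : R), IsUnit ε ∧ (a ≠ 0 ∨ b ≠ 0) ∧
          (a = 0 ∨ ¬ p ∣ a) ∧ (b = 0 ∨ ¬ p ∣ b) ∧
          (∑ j : Fin p, c' j ^ p * ū ^ (j : ℕ)) = (ε : κ) * (x₁ : κ) ^ a * (y₁ : κ) ^ b) ∨
        (∃ u : R, IsUnit u ∧ (∑ j : Fin p, c' j ^ p * ū ^ (j : ℕ)) = (u : κ) ∧ ∀ c'' : R, u - c'' ^ p ∉ maximalIdeal R)) := by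
  classical
  rcases hform with h1 | h2 | ⟨s, γ, hsum, hz1, hz2⟩
  · exact ⟨c, hc, hden, Or.inl h1⟩
  · exact ⟨c, hc, hden, Or.inr h2⟩
  -- form (3): shift `c₀` by `γ`
  haveI : NeZero p := ⟨hp.out.ne_zero⟩
  set c' : Fin p → κ := Function.update c 0 (c 0 - (γ : κ)) with hc'
  have hc'0 : c' 0 = c 0 - (γ : κ) := by rw [hc', Function.update_self]
  have hc'j : ∀ j : Fin p, j ≠ 0 → c' j = c j := fun j hj => by rw [hc', Function.update_of_ne hj]
  obtain ⟨z₂, hzz₂⟩ := exists_span_pair_of_not_mem_sq x y (s - γ ^ p) hxy hz1 hz2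
  refine ⟨c', ?_, ?_, Or.inl ⟨s - γ ^ p, z₂, hzz₂, 1, 0, 1, isUnit_one, Or.inl one_ne_zero,
    Or.inr (by rw [Nat.dvd_one]; exact hp.out.one_lt.ne'), Or.inl rfl, ?_⟩⟩
  · obtain ⟨j, hj, hcj⟩ := hc
    exact ⟨j, hj, by rwa [hc'j j (fun h => hj (by rw [h]; rfl))]⟩
  · intro j
    by_cases hj : j = 0
    · subst hj
      rw [hc'0, sub_mul, sub_mul, sub_mul]
      exact Subring.sub_mem _ (hden 0) (Subring.mul_mem _ (Subring.mul_mem _ (Subring.mul_mem _ γ.2 hd)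
        (Subring.pow_mem _ x.2 _)) (Subring.pow_mem _ y.2 _))
    · rw [hc'j j hj]; exact hden j
  · -- `Σ c'_j^p ū^j = Σ c_j^p ū^j − γ^p = s − γ^p`
    have hsplit : ∀ f : Fin p → κ, ∑ j : Fin p, f j = f 0 + ∑ j ∈ Finset.univ.erase 0, f j :=
      fun f => (Finset.add_sum_erase _ f (Finset.mem_univ 0)).symm
    have hrest : ∑ j ∈ Finset.univ.erase (0 : Fin p), c' j ^ p * ū ^ (j : ℕ) =
        ∑ j ∈ Finset.univ.erase (0 : Fin p), c j ^ p * ū ^ (j : ℕ) := by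
      refine Finset.sum_congr rfl fun j hj => ?_
      rw [hc'j j (Finset.ne_of_mem_erase hj)]
    have hsum' : ∑ j : Fin p, c' j ^ p * ū ^ (j : ℕ) = (∑ j : Fin p, c j ^ p * ū ^ (j : ℕ)) - (γ : κ) ^ p := by
      rw [hsplit (fun j => c' j ^ p * ū ^ (j : ℕ)), hsplit (fun j => c j ^ p * ū ^ (j : ℕ)), hrest, hc'0, sub_pow_char]
      simp only [Fin.val_zero, pow_zero, mul_one]
      ring
    rw [hsum', hsum, pow_one, pow_zero, mul_one, Subring.coe_one, one_mul]
    push_cast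
    ring

end Summit.ResolutionOfSingularities.ResolutionOfSingularities.Theorems.RadicialJung.CleanModels

end
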